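import Literature.Geometry.Riemannian.KarpukhinSternStabilization
import Literature.Geometry.Riemannian.KarpukhinSternStabilizationLimit
import Literature.Geometry.Riemannian.SectionalCurvatureCompactBound
import Literature.Geometry.Lorentzian.TracedGaussEquationGeneral
import HarnessLib

/-!
# Karpukhin–Stern, Cor. 1.3 with Thm. 1.5: the named fact from Theorem 3.2 and Lemma 3.6
(assembly file of the proof files of `KarpukhinSternHarmonicMaps.lean`; topic `Geometry/Riemannian`)

This file assembles everything proved in `KarpukhinSternHarmonicMapsProofs.lean` (§4 endgame,
Prop. 4.9, Lemma 3.3), `KarpukhinSternBochner.lean` (§3.1: Bochner, (3.3), Lemma 3.4, Prop. 3.5,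
index additivity), `KarpukhinSternStabilization.lean` (Prop. 3.5 on balls, Lemma 3.7 from
Lemma 3.6) and `KarpukhinSternStabilizationLimit.lean` (Prop. 3.8 from the `L⁶` bound) into

* `karpukhinStern_groundStateHarmonicMap_of_thm32_of_lemma36` — **the named fact
  `Literature.Geometry.Riemannian.karpukhinStern_groundStateHarmonicMap` (Karpukhin–Stern 2024,
  Cor. 1.3 with Thm. 1.5) follows from the two remaining inputs of the printed proof**, taken as
  explicit hypotheses in the vocabulary of the fact:
  - `h32` = KS **Theorem 3.2** (p. 745) for `3 ≤ n ≤ 5`: on every closed Riemannian `n`-manifold,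
    for all large `k`, a nonconstant smooth harmonic map `u : M → Sᵏ` (`tr Hess uᵢ = −|du|² uᵢ`)
    with `ind_E(u) ≤ k + 1` (the min–max maps of §2; for `n ≤ 5`, `k ≥ n` they are smooth; the
    index over smooth sections used here is at most KS's `W^{1,2}`-index, so the hypothesis is
    implied by the printed statement);
  - `h36` = KS **Lemma 3.6** (p. 750) for the same index: a radius `δ(M, g) > 0` with
    `ind_E(u; M ∖ B_δ(p)) ≥ k − 2` for every nonconstant smooth harmonic `u : M → Sᵏ` and every
    `p` (its printed proof — Lemma 3.3 with a cut-off, energy monotonicity and the energy gap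
    Prop. 5.5 — applies verbatim to the smooth-section index, `karpukhinStern_lemma33_on` being
    stated for it).
  The chain: `exists_neg_mul_le_ricci` (`Ric ≥ −K g` on the compact manifold) →
  `karpukhinStern_lemma37_of_lemma36` ((3.8)–(3.9)) → `karpukhinStern_prop38_of_L6bound` (`k₀`)
  → `h32` (`u_k` for `k ≥ max k₁ 2k₀`) → `groundState_of_harmonic_of_energyIndex_le` (Thm. 4.6:
  `ind_S(u_k) = 1`, the five clauses).
* `exists_neg_mul_le_ricci` — the Ricci curvature of a compact Riemannian manifold is bounded
  below (frame bound of `CurvatureFamilyBounds.lean` + `ricci_eq_sum_of_isOrthoᵢ`).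

Everything is proved; no definitions, no named facts, no hypothesis on the fact itself.

## References

* M. Karpukhin, D. Stern, *Existence of harmonic maps and eigenvalue optimization in higher
  dimensions*, Invent. Math. 236 (2024) 713–778: Cor. 1.3, Thm. 1.5, Thm. 3.2 (p. 745), Lemma 3.6
  (p. 750), Lemma 3.7, Prop. 3.8, Thm. 4.6 (pp. 757–761). [KarpukhinStern2024]
-/

noncomputable section

open Module Finset Bundle Set
open scoped Manifold ContDiff Topology BigOperators

namespace Literature.Geometry.Riemannian

namespace KarpukhinStern

open Lorentzian Lorentzian.PseudoRiemannianMetric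
open _root_.MeasureTheory

section Ricci

variable {E : Type*} [NormedAddCommGroup E] [NormedSpace ℝ E] [FiniteDimensional ℝ E]
  {H : Type*} [TopologicalSpace H] {I : ModelWithCorners ℝ E H}
  {M : Type*} [TopologicalSpace M] [ChartedSpace H M] [IsManifold I ∞ M] [T2Space M] [CompactSpace M]
  (g : PseudoRiemannianMetric I ∞ E (TangentSpace I : M → Type _)) [g.HasLeviCivita]

/-- **The Ricci curvature of a compact Riemannian manifold is bounded below**: there is `K ≥ 0`
with `Ric(v, v) ≥ −K g(v, v)` for all tangent vectors (the frame bound `|Rm| ≤ K₀` of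
`CurvatureFamilyBounds.lean` on the compact manifold, the trace formula
`Ric(v, v) = ∑ₐ Rm(fₐ, v, v, fₐ)` in an orthonormal frame, and `K = dim · K₀`). Karpukhin–Stern's
`‖Ric_M‖_{L∞}` in (3.3). [cite: KarpukhinStern2024, (3.3) p. 748] -/
theorem exists_neg_mul_le_ricci (hg : g.IsRiemannian) :
    ∃ K : ℝ, 0 ≤ K ∧ ∀ (x : M) (v : TangentSpace I x), -(K * g.val x v v) ≤ g.ricci x v v := by
  classical
  have hLC : g.IsLeviCivita g.leviCivita := isLeviCivita_leviCivita_holds (g := g)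
  obtain ⟨K₀, hK₀⟩ := (isContMDiffFamilyOn_const g {0}).exists_curvatureBoundedBy_of_isCompact
    (cov := fun _ : ℝ ↦ g.leviCivita) (fun _ _ ↦ hLC) isCompact_singleton (subset_refl _)
    (fun _ _ ↦ hg)
  have hK : CurvatureBoundedBy g g.leviCivita K₀ := hK₀ 0 (mem_singleton 0)
  set d := finrank ℝ E with hd
  refine ⟨d * max K₀ 0, by positivity, fun x v ↦ ?_⟩
  -- an orthonormal frame at `x`
  haveI := VectorBundle.finiteDimensional ℝ E (TangentSpace I : M → Type _) x
  obtain ⟨f, hf⟩ := g.exists_orthonormal_basis x hg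
  have hfO : (g.toBilinForm x).IsOrthoᵢ f := fun a c hac ↦ by
    change g.val x (f a) (f c) = 0
    rw [hf, if_neg hac]
  have hf1 : ∀ a, g.val x (f a) (f a) = 1 := fun a ↦ by rw [hf, if_pos rfl]
  have hric : g.ricci x v v = ∑ a, g.curvatureForm g.leviCivita x (f a) v v (f a) := by
    rw [ricci_eq_sum_of_isOrthoᵢ g x f hfO (fun a ↦ by rw [hf1]; exact one_ne_zero)]
    refine Finset.sum_congr rfl fun a _ ↦ ?_
    rw [hf1, div_one]
    rfl
  -- each term is `≥ −K₀ g(v,v)`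
  have hterm : ∀ a, -(max K₀ 0 * g.val x v v) ≤ g.curvatureForm g.leviCivita x (f a) v v (f a) := by
    intro a
    by_cases hv : v = 0
    · subst hv
      simp [PseudoRiemannianMetric.curvatureForm]
    have hvpos : 0 < g.val x v v := hg x v hv
    set r : ℝ := Real.sqrt (g.val x v v) with hr
    have hr0 : 0 < r := Real.sqrt_pos.2 hvpos
    have hr2 : r ^ 2 = g.val x v v := Real.sq_sqrt hvpos.le
    set w : TangentSpace I x := r⁻¹ • v with hw
    have hw1 : g.val x w w ≤ 1 := by
      simp only [hw, map_smul, smul_apply, smul_eq_mul]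
      rw [← hr2, ← mul_assoc, show r⁻¹ * r⁻¹ * r ^ 2 = 1 by field_simp]
    have hb := hK x (f a) w w (f a) (by rw [hf1]) hw1 hw1 (by rw [hf1])
    have hscale : g.curvatureForm g.leviCivita x (f a) v v (f a) =
        r ^ 2 * g.curvatureForm g.leviCivita x (f a) w w (f a) := by
      have hv' : v = r • w := by rw [hw, smul_smul, mul_inv_cancel₀ hr0.ne', one_smul]
      conv_lhs => rw [hv']
      simp only [PseudoRiemannianMetric.curvatureForm, map_smul, smul_apply, smul_eq_mul]
      ring
    rw [hscale, ← hr2]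
    have h1 : -max K₀ 0 ≤ g.curvatureForm g.leviCivita x (f a) w w (f a) :=
      (neg_le_neg (le_max_left _ _)).trans (neg_le_of_abs_le hb)
    nlinarith [sq_nonneg r]
  rw [hric]
  have hcard : ((Finset.univ : Finset (Fin (finrank ℝ (TangentSpace I x)))).card : ℝ) = d := by
    rw [Finset.card_univ, Fintype.card_fin, hd]
    rfl
  calc -(↑d * max K₀ 0 * g.val x v v) = ∑ _a : Fin (finrank ℝ (TangentSpace I x)), -(max K₀ 0 * g.val x v v) := by
        rw [Finset.sum_const, nsmul_eq_mul, hcard]; ring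
    _ ≤ ∑ a, g.curvatureForm g.leviCivita x (f a) v v (f a) := Finset.sum_le_sum fun a _ ↦ hterm a

end Ricci

/-- **The named fact from Karpukhin–Stern's Theorem 3.2 and Lemma 3.6.** See the module
docstring for the chain; `h32` and `h36` are the printed statements (for the smooth-section
energy index of this tree) of KS Thm. 3.2 (existence of the min–max harmonic maps `u_k` with
`ind_E(u_k) ≤ k + 1`, smooth for `3 ≤ n ≤ 5`, `k` large) and KS Lemma 3.6 (the index on the
complement of a small ball is `≥ k − 2`). [cite: KarpukhinStern2024, Cor. 1.3, Thm. 1.5, Thm. 3.2 p. 745, Lemma 3.6 p. 750, Thm. 4.6 pp. 760–761] -/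
theorem karpukhinStern_groundStateHarmonicMap_of_thm32_of_lemma36
    (h32 : ∀ (n : ℕ), 3 ≤ n → n ≤ 5 →
      ∀ (M : Type) [TopologicalSpace M] [T2Space M] [SecondCountableTopology M]
        [ChartedSpace (EuclideanSpace ℝ (Fin n)) M] [IsManifold (𝓡 n) ∞ M] [CompactSpace M]
        [ConnectedSpace M] [T3Space M] [MeasurableSpace M] [BorelSpace M]
        (g : Bundle.ContMDiffRiemannianMetric (𝓡 n) ∞ (EuclideanSpace ℝ (Fin n))
          (TangentSpace (𝓡 n) : M → Type _))
        (_ : (ofRiemannian g).HasLeviCivita),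
        ∃ k₁ : ℕ, ∀ k : ℕ, k₁ ≤ k →
          ∃ (u : M → Metric.sphere (0 : EuclideanSpace ℝ (Fin (k + 1))) 1)
            (hu : ContMDiff (𝓡 n) (𝓡 k) ∞ u),
            (∃ x y : M, u x ≠ u y) ∧
            (∀ (i : Fin (k + 1)) (x : M), (ofRiemannian g).dalembertian
              (fun y ↦ (u y : EuclideanSpace ℝ (Fin (k + 1))) i) x =
                -(energyDensity g u x) * (u x : EuclideanSpace ℝ (Fin (k + 1))) i) ∧
            energyIndex g hu ≤ (k + 1 : ℕ))
    (h36 : ∀ (n : ℕ), 3 ≤ n → n ≤ 5 →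
      ∀ (M : Type) [TopologicalSpace M] [T2Space M] [SecondCountableTopology M]
        [ChartedSpace (EuclideanSpace ℝ (Fin n)) M] [IsManifold (𝓡 n) ∞ M] [CompactSpace M]
        [ConnectedSpace M] [T3Space M] [MeasurableSpace M] [BorelSpace M]
        (g : Bundle.ContMDiffRiemannianMetric (𝓡 n) ∞ (EuclideanSpace ℝ (Fin n))
          (TangentSpace (𝓡 n) : M → Type _))
        (_ : (ofRiemannian g).HasLeviCivita),
        ∃ δ : ℝ, 0 < δ ∧ ∀ {k : ℕ} (u : M → Metric.sphere (0 : EuclideanSpace ℝ (Fin (k + 1))) 1)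
          (hu : ContMDiff (𝓡 n) (𝓡 k) ∞ u),
          (∀ (i : Fin (k + 1)) (x : M), (ofRiemannian g).dalembertian
            (fun y ↦ (u y : EuclideanSpace ℝ (Fin (k + 1))) i) x =
              -(energyDensity g u x) * (u x : EuclideanSpace ℝ (Fin (k + 1))) i) →
          (∃ x y : M, u x ≠ u y) →
          ∀ p : M, ((k - 2 : ℕ) : ℕ∞) ≤
            energyIndexOn g hu ((ofRiemannian g).ball p (ENNReal.ofReal δ))ᶜ) :
    karpukhinStern_groundStateHarmonicMap := by
  intro n hn3 hn5 M _ _ _ _ _ _ _ _ _ _ g hLC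
  haveI := hLC
  have hn2 : 2 ≤ n := by omega
  -- Ricci lower bound on the compact manifold
  obtain ⟨K, hK0, hK⟩ := exists_neg_mul_le_ricci (ofRiemannian g) (isRiemannian_ofRiemannian g)
  -- Lemma 3.6 (hypothesis) and Lemma 3.7
  obtain ⟨δ, hδ, h36'⟩ := h36 n hn3 hn5 M g hLC
  obtain ⟨C, hC⟩ := karpukhinStern_lemma37_of_lemma36 g hn2 hn5 hK hK0 hδ
    (fun u hu harm hne p ↦ h36' u hu harm hne p)
  -- Prop. 3.8
  have hL6 : ∀ {k : ℕ} (u : M → Metric.sphere (0 : EuclideanSpace ℝ (Fin (k + 1))) 1)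
      (hu : ContMDiff (𝓡 n) (𝓡 k) ∞ u),
      (∀ (i : Fin (k + 1)) (x : M), (ofRiemannian g).dalembertian
        (fun y ↦ (u y : EuclideanSpace ℝ (Fin (k + 1))) i) x =
          -(energyDensity g u x) * (u x : EuclideanSpace ℝ (Fin (k + 1))) i) →
      (∃ x y : M, u x ≠ u y) → 205 ≤ k → energyIndex g hu ≤ (k + 1 : ℕ) →
      ∫ x, energyDensity g u x ^ 3 ∂riemannianMeasure g ≤ max C 0 :=
    fun u hu harm hne hk hind ↦ (hC u hu harm hne hk hind).1.trans (le_max_left _ _)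
  obtain ⟨k₀', hk₀'⟩ := karpukhinStern_prop38_of_L6bound g hn3 hn5 (le_max_right C 0) hL6
  -- Theorem 3.2 (hypothesis)
  obtain ⟨k₁, hk₁⟩ := h32 n hn3 hn5 M g hLC
  refine ⟨max k₁ (2 * k₀'), fun k hk ↦ ?_⟩
  obtain ⟨u, hu, hne, harm, hind⟩ := hk₁ k ((le_max_left _ _).trans hk)
  set P := Submodule.span ℝ (Set.range fun x ↦ (u x : EuclideanSpace ℝ (Fin (k + 1)))) with hP
  have hPmem : ∀ x, (u x : EuclideanSpace ℝ (Fin (k + 1))) ∈ P := fun x ↦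
    Submodule.subset_span ⟨x, rfl⟩
  have hdim : finrank ℝ P ≤ k₀' := hk₀' u hu harm hind
  have hk2 : 2 * finrank ℝ P < k + 1 := by
    have : 2 * k₀' ≤ k := (le_max_right _ _).trans hk
    omega
  obtain ⟨e, hu', hne', he, harm', hray⟩ :=
    groundState_of_harmonic_of_energyIndex_le g hu hne harm hPmem hk2 hind
  exact ⟨u, e, hu', hne', he, harm', hray⟩

end KarpukhinStern

end Literature.Geometry.Riemannian
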